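import Summits.Ventures.CertifiedArithmetic.LowPrec.GemmEnvelopeOnset

/-!
# GEMM-level envelopes, part (w): THE OUTPUT-LEVEL ONSET OF ROW P3 IS EXACTLY `ρ_Π` (pub-lowprec gemm gen 23, LXXI-c)

HONEST FRAMING: certified error envelopes and provably optimal rounding/accumulation schemes for
low-precision formats under stated cost models; every table by two implementations; no hardware or vendor
claims.

Instances of the generic onset law of part (u) `GemmEnvelopeOnset` for row P3 (per-vector INT8 — scale
`A/127`, integer rounding `round` — against the per-vector constant
`C_Π = 35/289 + (γ̄ + δ̄(1 + γ̄))·324/289`), the cell's candidates L20c/L20d (THEOREM-SHAPES v7.10 §4.2).  With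
`ρ_Π² = (127/8)²·(1 + C_Π)/((1 - γ̄)(1 - δ̄)) = 345321906129/1211561984` at the caps `(γ̄, δ̄) = (1/2048, 1/257)`
(`ρ_Π ≈ 16.8826`; `1143/68 ≈ 16.81 < ρ_Π < 254/15 ≈ 16.93`):

* `int_round_ratio_band` / `intQ_ratio_band` / `intQ_cell_ratio`: on `C(κ)` with `κ < 254/15` every INT8
  element is `ρ·v` with `ρ ∈ [16/17, R]` for any `R ≥ max(18/17, 8κ/127)` (the scaled element `y = 127v/A` has
  `|y| ≥ 127/κ > 15/2`; `|y| ≥ 17/2` gives `|ρ - 1| ≤ 1/17`, `15/2 < |y| < 17/2` rounds to `±8`, ratio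
  `8/|y| ≤ 8κ/127`); cells carry `r ∈ [256/289, R²]`.
* `row_P3_no_output_witness` (generic caps and constant) and `row_P3_no_output_witness_below` (the instance
  `1211561984·κ² ≤ 345321906129` at the caps and `C_Π`): NO input of `C(κ)` is an output-level witness of
  `¬(INT8 ≼ VEC)` — some realisation has `|c - S| ≤ C_Π·L`, for every `B`, `k`.
* `intQ_blocked_le_ratio`: the `(0, 0)` instance — exact-accumulation INT8 envelope `(R² - 1)·L` on `C(κ)`,
  `κ < 254/15`: `35/289` up to `1143/68`, `(8κ/127)² - 1` on `[1143/68, 254/15)`.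
* `row_P3_output_witness` (generic caps `0 ≤ γ̄ < 1`, `0 ≤ δ̄ < 1`, `C ≥ 0`, onset
  `127²(1 + C) < 64(1 - γ̄)(1 - δ̄)κ²`, first-rung condition `225(1 + C) < 256(1 - γ̄)(1 - δ̄)`): for vectors of
  length `≥ 3` the pinned input `(127, 0, q, …)·(0, 127, q, …)`, `max(127/κ, 15/2) < q`,
  `q² < 64(1 - γ̄)(1 - δ̄)/(1 + C)` (`q ↦ 8`), separates for EVERY realisation;
  `row_P3_output_onset_above`: the instance at the caps, EVERY `κ > 0` with `345321906129 < 1211561984·κ²`.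
  So the output-level onset of row P3 is EXACTLY `ρ_Π`; under exact integer accumulation (`γ̄ = 0`, same
  `δ̄`) the same two generic theorems give the onset `(127/8)·√((1 + C)/(1 - δ̄))` instead.

Exact rational algebra over `round`; caps are hypotheses, not device claims.  No `sorry`; axioms `propext`,
`Classical.choice`, `Quot.sound` only.  [cite: MicikeviciusEtAl2022, §3] [cite: Higham2002ASNA, §3.1]
-/

namespace Summit.Ventures.CertifiedArithmetic.LowPrec.GemmEnvelope

open Finset

/-! ## The INT8 ratio band on `C(κ)`, `κ < 254/15` -/

/-- **INTEGER ROUNDING RATIO BAND**: for `y ≠ 0` with `127 ≤ κ|y|`, `κ < 254/15` (so `|y| > 15/2`),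
`round y = ρ·y` with `16/17 ≤ ρ ≤ R` for any `R ≥ max(18/17, 8κ/127)`. [folklore] -/
theorem int_round_ratio_band {y κ R : ℚ} (hy : y ≠ 0) (hκy : 127 ≤ κ * |y|) (hκM : κ < 254 / 15)
    (hR : 18 / 17 ≤ R) (hκR : 8 * κ ≤ 127 * R) :
    ∃ ρ : ℚ, 16 / 17 ≤ ρ ∧ ρ ≤ R ∧ (round y : ℚ) = ρ * y := by
  have hpos : 0 < |y| := abs_pos.mpr hy
  have h1 : κ * |y| < 254 / 15 * |y| := mul_lt_mul_of_pos_right hκM hpos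
  have h75 : 15 / 2 < |y| := by linarith
  have hRy : 8 ≤ R * |y| := by nlinarith [mul_le_mul_of_nonneg_right hκR hpos.le]
  by_cases h85 : 17 / 2 ≤ |y|
  · have hr : |(round y : ℚ) - y| ≤ 1 / 17 * |y| := by
      rw [abs_sub_comm]; exact le_trans (abs_sub_round y) (by linarith)
    have hρ : |(round y : ℚ) / y - 1| ≤ 1 / 17 := by
      rw [show (round y : ℚ) / y - 1 = ((round y : ℚ) - y) / y by field_simp, abs_div,
        div_le_iff₀ hpos]
      exact hr
    obtain ⟨hρ1, hρ2⟩ := abs_le.mp hρ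
    exact ⟨(round y : ℚ) / y, by linarith, by linarith, by rw [div_mul_cancel₀ _ hy]⟩
  · push Not at h85
    refine ⟨8 / |y|, ?_, ?_, ?_⟩
    · rw [le_div_iff₀ hpos]; linarith
    · rw [div_le_iff₀ hpos]; linarith
    · rcases lt_or_gt_of_ne hy with hneg | hposy
      · rw [abs_of_neg hneg] at h75 h85 ⊢
        have hr : round y = -8 := by
          rw [round_eq, Int.floor_eq_iff]; push_cast; constructor <;> linarith
        rw [hr]; push_cast
        field_simp
      · rw [abs_of_pos hposy] at h75 h85 ⊢
        have hr : round y = 8 := by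
          rw [round_eq, Int.floor_eq_iff]; push_cast; constructor <;> linarith
        rw [hr]; push_cast
        field_simp

/-- **INT8 RATIO BAND** (per-vector scale `A/127`, covering numerator `|v| ≤ A`, class `v = 0 ∨ A ≤ κ|v|`,
`κ < 254/15`): the quantised element is `ρ·v`, `16/17 ≤ ρ ≤ R`, for any `R ≥ max(18/17, 8κ/127)`.
[cite: MicikeviciusEtAl2022, §3] -/
theorem intQ_ratio_band {A v κ R : ℚ} (hv : |v| ≤ A) (hκ : v = 0 ∨ A ≤ κ * |v|) (hκM : κ < 254 / 15)
    (hR : 18 / 17 ≤ R) (hκR : 8 * κ ≤ 127 * R) :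
    ∃ ρ : ℚ, 16 / 17 ≤ ρ ∧ ρ ≤ R ∧ A / 127 * (round (v / (A / 127)) : ℚ) = ρ * v := by
  by_cases hv0 : v = 0
  · refine ⟨1, by norm_num, by linarith, ?_⟩
    rw [hv0, zero_div, round_zero]; simp
  have hκ' : A ≤ κ * |v| := hκ.resolve_left hv0
  have hpos : 0 < |v| := abs_pos.mpr hv0
  have hA : 0 < A := lt_of_lt_of_le hpos hv
  have hs : 0 < A / 127 := by positivity
  have hy : v / (A / 127) ≠ 0 := div_ne_zero hv0 hs.ne'
  have hκy : 127 ≤ κ * |v / (A / 127)| := by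
    rw [abs_div, abs_of_pos hs, mul_div_assoc', le_div_iff₀ hs]
    linarith
  obtain ⟨ρ, h1, h2, h3⟩ := int_round_ratio_band hy hκy hκM hR hκR
  refine ⟨ρ, h1, h2, ?_⟩
  rw [h3]
  field_simp

/-- The cell form of the INT8 band: `q̂a·q̂b = r·(a·b)` with `256/289 ≤ r ≤ R²`. -/
theorem intQ_cell_ratio {a b Aa Ab κ R : ℚ} (ha : |a| ≤ Aa) (hca : a = 0 ∨ Aa ≤ κ * |a|)
    (hb : |b| ≤ Ab) (hcb : b = 0 ∨ Ab ≤ κ * |b|) (hκM : κ < 254 / 15) (hR : 18 / 17 ≤ R)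
    (hκR : 8 * κ ≤ 127 * R) :
    ∃ r : ℚ, 256 / 289 ≤ r ∧ r ≤ R ^ 2 ∧
      (Aa / 127 * (round (a / (Aa / 127)) : ℚ)) * (Ab / 127 * (round (b / (Ab / 127)) : ℚ))
        = r * (a * b) := by
  obtain ⟨ρ, hρ1, hρ2, hρ⟩ := intQ_ratio_band ha hca hκM hR hκR
  obtain ⟨σ, hσ1, hσ2, hσ⟩ := intQ_ratio_band hb hcb hκM hR hκR
  refine ⟨ρ * σ, ?_, ?_, ?_⟩
  · have := mul_le_mul hρ1 hσ1 (by norm_num) (le_trans (by norm_num) hρ1)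
    linarith
  · rw [sq]; exact mul_le_mul hρ2 hσ2 (le_trans (by norm_num) hσ1) (le_trans (le_trans (by norm_num) hρ1) hρ2)
  · rw [hρ, hσ]; ring

/-! ## Row P3: the no-witness half below the onset -/

/-- **ROW P3, NO OUTPUT-LEVEL WITNESS (generic caps and constant)**: on `C(κ)`, `κ < 254/15`, `18/17 ≤ R`,
`8κ ≤ 127R`, caps `0 ≤ γ̄, δ̄ ≤ 1`, constant `C ≥ 0` with `(1 - γ̄)(1 - δ̄)R² ≤ 1 + C` and
`1 - (1 - δ̄)(1 + γ̄)·256/289 ≤ C`: EVERY input admits a realisation of the per-vector INT8 pipeline with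
`|c - S| ≤ C·L`. [cite: MicikeviciusEtAl2022, §3] [cite: Higham2002ASNA, §3.1] -/
theorem row_P3_no_output_witness {B k : ℕ} (a b : Fin B → Fin k → ℚ) {Aa Ab κ R γ δ C : ℚ}
    (hκM : κ < 254 / 15) (hR : 18 / 17 ≤ R) (hκR : 8 * κ ≤ 127 * R)
    (hC : 0 ≤ C) (hγ0 : 0 ≤ γ) (hγ1 : γ ≤ 1) (hδ0 : 0 ≤ δ) (hδ1 : δ ≤ 1)
    (hup : (1 - γ) * (1 - δ) * R ^ 2 ≤ 1 + C) (hdn : 1 - (1 - δ) * (1 + γ) * (256 / 289) ≤ C)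
    (ha : ∀ j i, |a j i| ≤ Aa ∧ (a j i = 0 ∨ Aa ≤ κ * |a j i|))
    (hb : ∀ j i, |b j i| ≤ Ab ∧ (b j i = 0 ∨ Ab ≤ κ * |b j i|)) :
    ∃ acc c : ℚ,
      |acc - ∑ j, ∑ i, (Aa / 127 * (round (a j i / (Aa / 127)) : ℚ)) *
          (Ab / 127 * (round (b j i / (Ab / 127)) : ℚ))|
        ≤ γ * ∑ j, ∑ i, |(Aa / 127 * (round (a j i / (Aa / 127)) : ℚ)) *
          (Ab / 127 * (round (b j i / (Ab / 127)) : ℚ))| ∧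
      |c - acc| ≤ δ * |acc| ∧
      |c - ∑ j, ∑ i, a j i * b j i| ≤ C * ∑ j, ∑ i, |a j i * b j i| := by
  have key := no_output_witness_of_ratio_band (ι := Fin B × Fin k) (fun x => a x.1 x.2 * b x.1 x.2)
    (fun x => (Aa / 127 * (round (a x.1 x.2 / (Aa / 127)) : ℚ)) *
      (Ab / 127 * (round (b x.1 x.2 / (Ab / 127)) : ℚ)))
    (rlo := 256 / 289) (rhi := R ^ 2) (γ := γ) (δ := δ) (C := C) hC hγ0 hγ1 hδ0 hδ1 (by norm_num)
    (fun x => intQ_cell_ratio (ha x.1 x.2).1 (ha x.1 x.2).2 (hb x.1 x.2).1 (hb x.1 x.2).2 hκM hR hκR)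
    hup hdn
  simp only [Fintype.sum_prod_type] at key
  exact key

/-- **ROW P3 BELOW THE ONSET `ρ_Π` (cell candidate L20d `RowP3NoOutputWitnessBelow`).**  At the caps
`(1/2048, 1/257)` and the constant `C_Π`: for `1211561984·κ² ≤ 345321906129` (`κ ≤ ρ_Π ≈ 16.8826`) NO input of
`C(κ)` is an output-level witness of `¬(INT8 ≼ VEC)` — some realisation has `|c - S| ≤ C_Π·L`, every `B`,
`k`.  (Up to `1143/68` every realisation does; the new content is the window `1143/68 < κ ≤ ρ_Π`.)
[cite: MicikeviciusEtAl2022, §3] -/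
theorem row_P3_no_output_witness_below {B k : ℕ} {κ : ℚ} (hκ : 1211561984 * κ ^ 2 ≤ 345321906129)
    (a b : Fin B → Fin k → ℚ) {Aa Ab : ℚ}
    (ha : ∀ j i, |a j i| ≤ Aa ∧ (a j i = 0 ∨ Aa ≤ κ * |a j i|))
    (hb : ∀ j i, |b j i| ≤ Ab ∧ (b j i = 0 ∨ Ab ≤ κ * |b j i|)) :
    ∃ acc c : ℚ,
      |acc - ∑ j, ∑ i, (Aa / 127 * (round (a j i / (Aa / 127)) : ℚ)) *
          (Ab / 127 * (round (b j i / (Ab / 127)) : ℚ))|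
        ≤ 1 / 2048 * ∑ j, ∑ i, |(Aa / 127 * (round (a j i / (Aa / 127)) : ℚ)) *
          (Ab / 127 * (round (b j i / (Ab / 127)) : ℚ))| ∧
      |c - acc| ≤ 1 / 257 * |acc| ∧
      |c - ∑ j, ∑ i, a j i * b j i|
        ≤ (35 / 289 + 1 / 2048 * (324 / 289) + 1 / 257 * (324 / 289) * (1 + 1 / 2048))
          * ∑ j, ∑ i, |a j i * b j i| := by
  by_cases hθ : κ ≤ 1143 / 68
  · exact row_P3_no_output_witness a b (R := 18 / 17) (by linarith) le_rfl (by linarith) (by norm_num)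
      (by norm_num) (by norm_num) (by norm_num) (by norm_num) (by norm_num) (by norm_num) ha hb
  · push Not at hθ
    have hκpos : 0 < κ := by linarith
    have hκM : κ < 254 / 15 := by nlinarith
    exact row_P3_no_output_witness a b (R := 8 * κ / 127) hκM (by linarith) (by linarith) (by norm_num)
      (by norm_num) (by norm_num) (by norm_num) (by norm_num) (by rw [div_pow, mul_pow]; linarith)
      (by norm_num) ha hb

/-- The `(0, 0)` instance: exact-accumulation INT8 envelope in ratio form on `C(κ)`, `κ < 254/15`:
`|ΣΣ q̂a q̂b - S| ≤ (R² - 1)·L` for every `R ≥ max(18/17, 8κ/127)` (`35/289` up to `1143/68`, then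
`(8κ/127)² - 1`). [cite: MicikeviciusEtAl2022, §3] -/
theorem intQ_blocked_le_ratio {B k : ℕ} (a b : Fin B → Fin k → ℚ) {Aa Ab κ R : ℚ}
    (hκM : κ < 254 / 15) (hR : 18 / 17 ≤ R) (hκR : 8 * κ ≤ 127 * R)
    (ha : ∀ j i, |a j i| ≤ Aa ∧ (a j i = 0 ∨ Aa ≤ κ * |a j i|))
    (hb : ∀ j i, |b j i| ≤ Ab ∧ (b j i = 0 ∨ Ab ≤ κ * |b j i|)) :
    |∑ j, ∑ i, (Aa / 127 * (round (a j i / (Aa / 127)) : ℚ)) * (Ab / 127 * (round (b j i / (Ab / 127)) : ℚ))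
        - ∑ j, ∑ i, a j i * b j i| ≤ (R ^ 2 - 1) * ∑ j, ∑ i, |a j i * b j i| := by
  have hR2 : 324 / 289 ≤ R ^ 2 := by nlinarith
  obtain ⟨acc, c, hacc, hc, hS⟩ := row_P3_no_output_witness a b (γ := 0) (δ := 0) (C := R ^ 2 - 1)
    hκM hR hκR (by linarith) le_rfl (by norm_num) le_rfl (by norm_num) (by linarith) (by norm_num; linarith)
    ha hb
  rw [zero_mul] at hacc hc
  have e1 := abs_nonpos_iff.mp hacc
  have e2 := abs_nonpos_iff.mp hc
  rw [sub_eq_zero] at e1 e2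
  rw [e2, e1] at hS
  exact hS

/-! ## Row P3: the witness half above the onset -/

/-- **ROW P3, OUTPUT-LEVEL WITNESS ABOVE THE ONSET (generic caps and constant)**: caps `0 ≤ γ̄ < 1`,
`0 ≤ δ̄ < 1`, `C ≥ 0`, onset `127²(1 + C) < 64(1 - γ̄)(1 - δ̄)κ²` (`κ > ρ_Π(γ̄, δ̄; C)`, `κ > 0`), first rung
`225(1 + C) < 256(1 - γ̄)(1 - δ̄)`: for vectors of length `≥ 3` the pinned INT8 input `(127, 0, q, …)·(0, 127, q, …)`
with `max(127/κ, 15/2) < q`, `q² < 64(1 - γ̄)(1 - δ̄)/(1 + C)` (`q ↦ 8`, numerator `127` attained) lies in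
`C(κ)` and has `C·L < |c - S|` for EVERY realisation. [cite: MicikeviciusEtAl2022, §3]
[cite: Higham2002ASNA, §3.1] -/
theorem row_P3_output_witness {B k : ℕ} (hB : 0 < B) (hk : 3 ≤ k) {κ γb δb C : ℚ} (hκ0 : 0 < κ)
    (hγb0 : 0 ≤ γb) (hγb : γb < 1) (hδb0 : 0 ≤ δb) (hδb : δb < 1) (hC : 0 ≤ C)
    (honset : 127 ^ 2 * (1 + C) < 64 * ((1 - γb) * (1 - δb)) * κ ^ 2)
    (hrung : 225 * (1 + C) < 256 * ((1 - γb) * (1 - δb))) :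
    ∃ (a b : Fin B → Fin k → ℚ) (Aa Ab : ℚ),
      (∀ j i, |a j i| ≤ Aa ∧ (a j i = 0 ∨ Aa ≤ κ * |a j i|)) ∧
      (∀ j i, |b j i| ≤ Ab ∧ (b j i = 0 ∨ Ab ≤ κ * |b j i|)) ∧
      ∀ (γ δ acc c : ℚ), γ ≤ γb → δ ≤ δb →
        |acc - ∑ j, ∑ i, (Aa / 127 * (round (a j i / (Aa / 127)) : ℚ)) *
            (Ab / 127 * (round (b j i / (Ab / 127)) : ℚ))|
          ≤ γ * ∑ j, ∑ i, |(Aa / 127 * (round (a j i / (Aa / 127)) : ℚ)) *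
            (Ab / 127 * (round (b j i / (Ab / 127)) : ℚ))| →
        |c - acc| ≤ δ * |acc| →
        C * ∑ j, ∑ i, |a j i * b j i| < |c - ∑ j, ∑ i, a j i * b j i| := by
  obtain ⟨n, rfl⟩ : ∃ n, k = n + 3 := ⟨k - 3, by omega⟩
  have hC1 : 0 < 1 + C := by linarith
  have h1γδ : 0 < (1 - γb) * (1 - δb) := mul_pos (by linarith) (by linarith)
  set T : ℚ := 64 * ((1 - γb) * (1 - δb)) / (1 + C) with hTdef
  have hTpos : 0 < T := by rw [hTdef]; positivity
  have hT1 : T ≤ 64 := by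
    rw [hTdef, div_le_iff₀ hC1]
    have : (1 - γb) * (1 - δb) ≤ 1 := by nlinarith
    linarith
  have hTC : (1 + C) * T = (1 - γb) * (1 - δb) * (8 * 8) := by
    rw [hTdef]; field_simp; ring
  obtain ⟨m, hm0, hm127, hm15, hmT⟩ : ∃ m : ℚ, 0 < m ∧ 127 / κ ≤ m ∧ 15 / 2 ≤ m ∧ m ^ 2 < T := by
    by_cases h : 127 / κ ≤ 15 / 2
    · refine ⟨15 / 2, by norm_num, h, le_rfl, ?_⟩
      rw [hTdef, lt_div_iff₀ hC1]
      linarith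
    · push Not at h
      refine ⟨127 / κ, div_pos (by norm_num) hκ0, le_rfl, h.le, ?_⟩
      rw [div_pow, div_lt_iff₀ (by positivity), hTdef, div_mul_eq_mul_div, lt_div_iff₀ hC1]
      linarith
  obtain ⟨q, hmq, hqT⟩ := exists_rat_gt_sq_lt hm0 hmT
  have hq0 : 0 < q := lt_trans hm0 hmq
  have hq15 : 15 / 2 < q := lt_of_le_of_lt hm15 hmq
  have hq8 : q < 8 := by nlinarith
  have hκq : 127 ≤ κ * q := by
    have : 127 / κ < q := lt_of_le_of_lt hm127 hmq
    rw [div_lt_iff₀ hκ0, mul_comm] at this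
    exact this.le
  set a' : Fin (n + 3) → ℚ := Fin.cases (127 : ℚ) (Fin.cases (0 : ℚ) (fun _ : Fin (n + 1) => q)) with ha'
  set b' : Fin (n + 3) → ℚ := Fin.cases (0 : ℚ) (Fin.cases (127 : ℚ) (fun _ : Fin (n + 1) => q)) with hb'
  obtain ⟨hca, hcb, ha0, hb1⟩ := pinned_class (n := n) hq0 (by linarith : q ≤ 127) hκq ha' hb'
  obtain ⟨hS1, hS1a, hS2, hS3⟩ := pinned_sums (n := n) (A := 127) (x := q)
    (fun y : ℚ => (127 : ℚ) / 127 * (round (y / (127 / 127)) : ℚ)) (by simp) ha' hb'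
  have h8 : (127 : ℚ) / 127 * (round (q / (127 / 127)) : ℚ) = 8 := by
    have hr : round (q / (127 / 127)) = 8 := by
      rw [show q / (127 / 127) = q by norm_num, round_eq, Int.floor_eq_iff]
      push_cast; constructor <;> linarith
    rw [hr]; norm_num
  rw [h8] at hS1 hS1a
  refine ⟨fun _ => a', fun _ => b', 127, 127, fun _ i => hca i, fun _ i => hcb i, ?_⟩
  intro γ δ acc c hγ hδ hacc hc
  simp only [hS1, hS1a, hS2, hS3, sum_const, card_univ, Fintype.card_fin, nsmul_eq_mul] at hacc ⊢
  have hN : (0 : ℚ) < (B : ℚ) * ((n + 1 : ℕ) : ℚ) := by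
    have : (0 : ℚ) < (B : ℚ) := by exact_mod_cast hB
    positivity
  have e1 : ((B : ℚ) * (((n + 1 : ℕ) : ℚ) * (8 * 8)) : ℚ) = (B : ℚ) * ((n + 1 : ℕ) : ℚ) * (8 * 8) := by ring
  have e2 : ((B : ℚ) * (((n + 1 : ℕ) : ℚ) * |(8 : ℚ) * 8|) : ℚ) = (B : ℚ) * ((n + 1 : ℕ) : ℚ) * |(8 : ℚ) * 8| := by
    ring
  have e3 : ((B : ℚ) * (((n + 1 : ℕ) : ℚ) * (q * q)) : ℚ) = (B : ℚ) * ((n + 1 : ℕ) : ℚ) * (q * q) := by ring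
  have e4 : ((B : ℚ) * (((n + 1 : ℕ) : ℚ) * |q * q|) : ℚ) = (B : ℚ) * ((n + 1 : ℕ) : ℚ) * |q * q| := by ring
  rw [e1, e2] at hacc
  rw [e3, e4]
  have hnum : (C + 1) * (q * q) < (1 - γb) * (1 - δb) * (8 * 8) := by
    rw [← hTC, ← sq, add_comm]
    exact mul_lt_mul_of_pos_left hqT hC1
  exact pipeline_witness_up_of_caps hN (by norm_num) (mul_pos hq0 hq0) hγb hδb hγ hδ hacc hc hnum

/-- **ROW P3 ABOVE THE ONSET `ρ_Π` (cell candidate L20c `RowP3OutputOnsetAbove`, EVERY `κ > ρ_Π`).**  At the caps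
`(1/2048, 1/257)`: for every `κ > 0` with `345321906129 < 1211561984·κ²` and vectors of length `≥ 3` an input
of `C(κ)` has `C_Π·L < |c - S|` for EVERY realisation of the per-vector INT8 pipeline.  With
`row_P3_no_output_witness_below`: the output-level onset of row P3 is EXACTLY `ρ_Π`, strictly between the
quantiser-level threshold `1143/68` and `254/15`.  (`0 < κ` is necessary.) [cite: MicikeviciusEtAl2022, §3] -/
theorem row_P3_output_onset_above {B k : ℕ} (hB : 0 < B) (hk : 3 ≤ k) {κ : ℚ} (hκ0 : 0 < κ)
    (hκ : 345321906129 < 1211561984 * κ ^ 2) :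
    ∃ (a b : Fin B → Fin k → ℚ) (Aa Ab : ℚ),
      (∀ j i, |a j i| ≤ Aa ∧ (a j i = 0 ∨ Aa ≤ κ * |a j i|)) ∧
      (∀ j i, |b j i| ≤ Ab ∧ (b j i = 0 ∨ Ab ≤ κ * |b j i|)) ∧
      ∀ (γ δ acc c : ℚ), γ ≤ 1 / 2048 → δ ≤ 1 / 257 →
        |acc - ∑ j, ∑ i, (Aa / 127 * (round (a j i / (Aa / 127)) : ℚ)) *
            (Ab / 127 * (round (b j i / (Ab / 127)) : ℚ))|
          ≤ γ * ∑ j, ∑ i, |(Aa / 127 * (round (a j i / (Aa / 127)) : ℚ)) *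
            (Ab / 127 * (round (b j i / (Ab / 127)) : ℚ))| →
        |c - acc| ≤ δ * |acc| →
        (35 / 289 + 1 / 2048 * (324 / 289) + 1 / 257 * (324 / 289) * (1 + 1 / 2048))
            * ∑ j, ∑ i, |a j i * b j i| < |c - ∑ j, ∑ i, a j i * b j i| :=
  row_P3_output_witness hB hk hκ0 (by norm_num) (by norm_num) (by norm_num) (by norm_num) (by norm_num)
    (by linarith) (by norm_num)

end Summit.Ventures.CertifiedArithmetic.LowPrec.GemmEnvelope
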